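import Summits.AtomisticToContinuum.HydrodynamicLimit.Theorems.RelayRaceLocalityConeLocalisationStubAssembly
import Summits.AtomisticToContinuum.HydrodynamicLimit.Theorems.RelayRaceLocalityConeLocalisationStubConeStep
import Summits.AtomisticToContinuum.HydrodynamicLimit.Theorems.RelayRaceLocalityConeLocalisationStubComparison
import Summits.AtomisticToContinuum.HydrodynamicLimit.Theorems.RelayRaceLocalityConeLocalisationStubStatics
import Summits.AtomisticToContinuum.HydrodynamicLimit.Theorems.RelayRaceLocalityConeLocalisationStubFlatteningLinear
import HarnessLib

/-!
# RelayRaceLocality · ConeLocalisation — the floored crux modulo the two open stubs (line `Sketch`, cycle 1)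

`ConeLocalisationFloored` (`LightConeInLaw → NearConstantShortTimeHL → S♭`, the crux `ConeLocalisation` of
stmt-AtomisticToContinuum-12504 after the density-floor restatement) follows from the two still-open registered stubs
`FlatteningDensity` (nonlinear flattening of the reduced density through the activity map) and `BubbleAtScale`
(bubbles at scale `r` with an `r`-free `C¹` guard), by composing the five LANDED stubs of the line: `stub_assembly`
(p134086), `stub_coneStep` (p134338), `stub_comparison` (p134341), `stub_statics` (p134298), `stub_flatteningLinear`
(p134308). Lead prover-line-stmt-AtomisticToContinuum-12504-0, 2026-08-17.
-/

noncomputable section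

namespace Summit.AtomisticToContinuum.HydrodynamicLimit.Theorems.ConeLocalisation

open Summit.AtomisticToContinuum.HydrodynamicLimit.Theses.RelayRaceLocality

/-- **`ConeLocalisationFloored` modulo `FlatteningDensity` and `BubbleAtScale`** (composition of the five landed
stubs of line `Sketch`). [folklore] -/
theorem coneLocalisationFloored_of_parts (hF : FlatteningDensity) (hP : BubbleAtScale) : ConeLocalisationFloored :=
  fun hA hB => stub_assembly (stub_coneStep (stub_comparison hP stub_statics stub_flatteningLinear hF) hA hB)

end Summit.AtomisticToContinuum.HydrodynamicLimit.Theorems.ConeLocalisation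

end
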